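import Literature.Topology.FourManifolds.HomotopySpheresBPOrderFrontier
import Literature.Topology.FourManifolds.HomotopySpheresSignatureReduction
import Literature.Topology.FourManifolds.SmaleHomologySpheresDouble
import Literature.Topology.FourManifolds.HCobordismThreeLeaves
import HarnessLib

/-!
# `|bP₈| = 28`: the discharge file of `HomotopySphereClass.natCard_bP_seven`

Topic `Literature/Topology/FourManifolds`; pure-proof sibling of `HomotopySpheresBPOrder.lean`, the
host of the named fact `Literature.Topology.FourManifolds.HomotopySphereClass.natCard_bP_seven`
(`Nat.card (bP 7) = 28`: the subgroup `bP₈ ⊆ Θ₇` of oriented-diffeomorphism classes of smooth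
homotopy `7`-spheres bounding a compact parallelizable `8`-manifold has `28` elements — Kervaire–
Milnor, *Groups of homotopy spheres I*, Ann. of Math. 77 (1963), §7, Thm. 7.5, Cor. 7.6 and the
Discussion pp. 530–531, "`bP₄ₘ` is cyclic of order precisely `σₘ/8`", with `σ₂/8 = 28` from the
table p. 504; complete printed proof: Kosinski, *Differential Manifolds* (1993), Ch. X §6,
Prop. 6.2(a) and p. 217, "Since `t₂/8 = 28`, it follows that `bP⁸ = ℤ₂₈`"). This is the file in
which the discharge `natCard_bP_seven_holds` is to land. Everything here is **proved**; no
definition, no named fact and no statement is added or changed (net debt `0`).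

The fact is glue. `HomotopySpheresBPOrderProofs.lean` assembles it from `18` named facts
(`HomotopySphereClass.natCard_bP_seven_of_leaves`) and `HomotopySpheresBPOrderFrontier.lean` from
the `9` that were still undischarged when it was written (`HomotopySphereClass.natCard_bP_seven_of_frontier`).
Since then the comparison "`Σ ∈ bP₄ₘ` ⇒ `signatureSet Σ ≠ ∅`" (Kervaire–Milnor §4, definition of
`bPₙ₊₁`, with the standing orientation conventions of §7, footnote pp. 528–529) has been
discharged: `HomotopySphere.nonempty_signatureSet_of_boundsParallelizable_holds`
(`HomotopySpheresSignatureProofs.lean`). This file records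

* `HomotopySphereClass.natCard_bP_seven_of_frontier'` — **`|bP₈| = 28` from the `8` named facts
  that remain**, in the shape in which `natCard_bP_seven_holds` will consume their `_holds`:
  Kervaire–Milnor's Thm. 7.5 (`HomotopySphere.mk_eq_mk_iff_sigmaGen_dvd_sub`); Kosinski's X.2.2/
  X.3.3, highly connected s-parallelizable representatives of a signature
  (`HomotopySphere.exists_highlyConnected_of_mem_signatureSet`); Kosinski's X.3.1, evenness of the
  intersection form of a framed manifold (`HomotopySphere.isEven_intersectionForm_closedModel`);
  Milnor's `E₈`-plumbing, Kosinski VI.12 with IX.7.5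
  (`HomotopySphere.exists_intersectionForm_equivalent_e8Form`); Milnor's Prop. B, smooth simply
  connected homology `n`-spheres, `n ≥ 5`, are topological spheres
  (`nonempty_homeomorph_sphere_of_homologySphere_of_five_le`); additivity of `σ` over connected
  sums along the boundary, Kervaire–Milnor §2 and p. 529
  (`HomotopySphere.add_mem_signatureSet_of_isOrientedConnectedSum`); and the two halves of
  `σ₂ = 224` (`HomotopySphere.twoHundredTwentyFour_dvd_of_mem_signatureSet_sphere`,
  `HomotopySphere.exists_twoHundredTwentyFour_mem_signatureSet_sphere`; Kervaire–Milnor p. 530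
  with Milnor–Kervaire 1960, Kosinski IX.8.7).
* `HomotopySphereClass.natCard_bP_seven_of_hcobordism_theorem` — **the same over the deepest
  current leaves of the tree**: two of the eight facts are themselves reduced elsewhere, WITHOUT
  new named facts, to Milnor's Thm. 9.1 (the h-cobordism theorem,
  `isTrivial_of_isHCobordism_of_five_le`): Thm. 7.5 is Lemma 7.3 (in the form in which p. 530
  invokes it; the framed surgery of §§5–7, not in the tree) + Smale's theorem + §2-additivity
  (`HomotopySphere.mk_eq_mk_iff_sigmaGen_dvd_sub_of_lemma73`, `HomotopySpheresSignatureReduction.lean`),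
  Smale's theorem `nonempty_diffeomorph_of_isHCobordant_of_five_le` being Thm. 9.1 + the proved
  `Cobordism.nonempty_diffeomorph_of_isTrivial_holds` (`nonempty_diffeomorph_of_isHCobordant_of_five_le_of_isTrivial`);
  and Prop. B follows from Thm. 9.1 alone
  (`nonempty_homeomorph_sphere_of_homologySphere_of_five_le_of_hcobordism_theorem`,
  `SmaleHomologySpheresDouble.lean`). Hence `|bP₈| = 28` GIVEN: Lemma 7.3 (hypothesis `h73`),
  Thm. 9.1 at universe `0`, and the six named facts X.2.2/X.3.3, X.3.1, `E₈`-plumbing,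
  §2-additivity, `224 ∣ σ` and `224` occurs. (Thm. 9.1 is in turn F78 + theorems, and F78 the
  three leaves B, I, W of Milnor's proof DAG: `HCobordismThreeLeaves.lean`,
  `isTrivial_of_isHCobordism_of_five_le_of_f78`,
  `Milnor1965_exists_isMorseFunction_forall_not_isMCriticalPt_of_three_leaves`.)

So the printed results separating the tree from `natCard_bP_seven_holds` are exactly: framed
surgery (Kervaire–Milnor Lemma 7.3; Kosinski X.2.2 below the middle dimension), the h-cobordism
theorem (Milnor 1965, Thm. 9.1, through its leaves Thm. 7.6, Cor. 7.3, Thm. 6.6), additivity of the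
signature, the Wu-class evenness X.3.1, Milnor's `E₈`-plumbing, and `σ₂ = 224` (Hirzebruch's `L₂`,
Bott periodicity and `j₂ = 240`).

## References

* M. Kervaire, J. Milnor, *Groups of homotopy spheres I*, Ann. of Math. 77 (1963), 504–537:
  table p. 504; §2 (pp. 505–508); §4 (definition of `bPₙ₊₁`, p. 510); §7: Lemma 7.3 (p. 528),
  footnote pp. 528–529, Thm. 7.5 and its proof (pp. 529–530), Cor. 7.6 and Discussion
  (pp. 530–531). doi:10.2307/1970128 [KervaireMilnorAnnals1963]
* A. Kosinski, *Differential Manifolds*, Academic Press (1993), Ch. X §2 (2.2), §3 (3.1)–(3.4),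
  §6 Prop. 6.2(a) (p. 216) and p. 217 (`bP⁸ = ℤ₂₈`); VI.12; IX.7.5, IX.8.7. [Kosinski1993]
* J. Milnor, *Lectures on the h-cobordism theorem*, Princeton (1965), Thm. 9.1 (p. 107), §9
  Prop. B and Corollary (p. 109); Thm. 6.6, Cor. 7.3, Thm. 7.6, Thm. 7.8. [MilnorHCobordism1965]
* S. Smale, *On the structure of manifolds*, Amer. J. Math. 84 (1962), Cor. 1.3. [Smale1962]
-/

open scoped Manifold ContDiff Topology
open Literature.AlgebraicTopology.SingularHomology (HomologicalOrientation)

noncomputable section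

namespace Literature.Topology.FourManifolds

namespace HomotopySphereClass

/-- **`|bP₈| = 28` over the current frontier of named facts (`8` leaves).** The assembly
`HomotopySphereClass.natCard_bP_seven_of_frontier` (`HomotopySpheresBPOrderFrontier.lean`, `9`
leaves) with the comparison "`Σ` bounds a parallelizable manifold ⇒ `signatureSet Σ` is nonempty"
fed its discharge `HomotopySphere.nonempty_signatureSet_of_boundsParallelizable_holds`
(Kervaire–Milnor §4, p. 510, with §7, footnote pp. 528–529). What remains, one hypothesis each:
Kervaire–Milnor's Thm. 7.5 (`h75`); Kosinski's X.2.2/X.3.3 (`hconn`) and X.3.1 (`heven`); Milnor's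
`E₈`-plumbing (`hΓ`); Milnor's Prop. B (`hPB`); additivity of `σ` over sums along the boundary
(`hadd`); `224 ∣ σ(M)` for the s-parallelizable `M⁸` bounded by `S⁷` (`hdvd`) and `σ(M) = 224`
occurs (`hex`). The discharge `natCard_bP_seven_holds` is this theorem applied to the eight
`_holds`. Kervaire–Milnor 1963, §7 (Thm. 7.5, Cor. 7.6, pp. 528–531: `bP₄ₘ ↪ ℤ/σₘ`, "cyclic of
order precisely `σₘ/8`"); Kosinski 1993, Ch. X §6, Prop. 6.2(a) and p. 217 ("Since `t₂/8 = 28`,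
it follows that `bP⁸ = ℤ₂₈`"). [cite: KervaireMilnorAnnals1963, §7, Thm. 7.5, Cor. 7.6 and Discussion pp. 530–531; table p. 504] [cite: Kosinski1993, Ch. X §6, Prop. 6.2(a) (p. 216) and p. 217 (bP⁸ = ℤ₂₈)] -/
theorem natCard_bP_seven_of_frontier'
    (h75 : HomotopySphere.mk_eq_mk_iff_sigmaGen_dvd_sub)
    (hconn : HomotopySphere.exists_highlyConnected_of_mem_signatureSet)
    (heven : HomotopySphere.isEven_intersectionForm_closedModel)
    (hΓ : HomotopySphere.exists_intersectionForm_equivalent_e8Form)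
    (hPB : nonempty_homeomorph_sphere_of_homologySphere_of_five_le.{0})
    (hadd : HomotopySphere.add_mem_signatureSet_of_isOrientedConnectedSum)
    (hdvd : HomotopySphere.twoHundredTwentyFour_dvd_of_mem_signatureSet_sphere)
    (hex : HomotopySphere.exists_twoHundredTwentyFour_mem_signatureSet_sphere) :
    natCard_bP_seven :=
  natCard_bP_seven_of_frontier h75
    HomotopySphere.nonempty_signatureSet_of_boundsParallelizable_holds hconn heven hΓ hPB hadd
    hdvd hex

/-- **`|bP₈| = 28` from Kervaire–Milnor's Lemma 7.3, the h-cobordism theorem and six named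
facts.** GIVEN: (`h73`) Lemma 7.3 in the form in which the proof of Thm. 7.5 invokes it (p. 530:
for `n + 1 = 4m`, `m > 1`, a homotopy `n`-sphere `Σ = bM` with `M` compact s-parallelizable and
`σ(M) = 0`, for some homological orientation of the closed model `M ∪ cone(bM)`, bounds a
contractible manifold — Lemma 7.3, p. 528, with Thm. 6.6, p. 526, and `bM₁ = bM`, p. 514; the
framed surgery of §§5–7); (`h91`) Milnor's Thm. 9.1, the h-cobordism theorem, at universe `0`
(`isTrivial_of_isHCobordism_of_five_le`); and the named facts X.2.2/X.3.3 (`hconn`), X.3.1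
(`heven`), the `E₈`-plumbing (`hΓ`), §2-additivity (`hadd`), `224 ∣ σ` (`hdvd`) and `224` occurs
(`hex`) — then `Nat.card (bP 7) = 28`. Proof: Thm. 7.5 is `h73` + Smale's theorem + `hadd`
(`HomotopySphere.mk_eq_mk_iff_sigmaGen_dvd_sub_of_lemma73`), Smale's theorem
(`nonempty_diffeomorph_of_isHCobordant_of_five_le`) being Thm. 9.1 with the proved
`Cobordism.nonempty_diffeomorph_of_isTrivial_holds`; Milnor's Prop. B is Thm. 9.1 alone
(`nonempty_homeomorph_sphere_of_homologySphere_of_five_le_of_hcobordism_theorem`); then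
`natCard_bP_seven_of_frontier'`. [cite: KervaireMilnorAnnals1963, §7, Lemma 7.3 (p. 528), Thm. 7.5 (pp. 529–530), Cor. 7.6 and Discussion pp. 530–531; Remark p. 505] [cite: MilnorHCobordism1965, Thm. 9.1 (p. 107) and §9 Prop. B (p. 109)] [cite: Kosinski1993, Ch. X §6, Prop. 6.2(a) and p. 217] -/
theorem natCard_bP_seven_of_hcobordism_theorem
    (h73 : ∀ (n m : ℕ) (h : n + 1 = 4 * m), 1 < m →
      ∀ (S : HomotopySphere n) (c : NullCobordism n S.carrier)
        (μ' : HomologicalOrientation ℤ (ClosedModel n c.W) (n + 1)),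
        IsStablyParallelizable (𝓡∂ (n + 1)) c.W →
          μ'.signatureInDim (show 2 * m + 2 * m = n + 1 by omega) = 0 →
            BoundsContractible n S.carrier)
    (h91 : isTrivial_of_isHCobordism_of_five_le.{0})
    (hconn : HomotopySphere.exists_highlyConnected_of_mem_signatureSet)
    (heven : HomotopySphere.isEven_intersectionForm_closedModel)
    (hΓ : HomotopySphere.exists_intersectionForm_equivalent_e8Form)
    (hadd : HomotopySphere.add_mem_signatureSet_of_isOrientedConnectedSum)
    (hdvd : HomotopySphere.twoHundredTwentyFour_dvd_of_mem_signatureSet_sphere)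
    (hex : HomotopySphere.exists_twoHundredTwentyFour_mem_signatureSet_sphere) :
    natCard_bP_seven :=
  -- Smale's theorem (spc4.S15) from Milnor's Thm. 9.1 and the proved product-cobordism lemma
  have hcob : nonempty_diffeomorph_of_isHCobordant_of_five_le.{0} :=
    nonempty_diffeomorph_of_isHCobordant_of_five_le_of_isTrivial.{0} h91
      (fun {_ _ _} _ _ _ _ => Cobordism.nonempty_diffeomorph_of_isTrivial_holds)
  natCard_bP_seven_of_frontier'
    (HomotopySphere.mk_eq_mk_iff_sigmaGen_dvd_sub_of_lemma73 h73 hcob hadd) hconn heven hΓ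
    (nonempty_homeomorph_sphere_of_homologySphere_of_five_le_of_hcobordism_theorem h91) hadd hdvd
    hex

end HomotopySphereClass

end Literature.Topology.FourManifolds

end
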